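import Summits.ResolutionOfSingularities.ResolutionOfSingularities.Theorems.MarkedTransferCampaignW46ThreefoldsGammaFreeGlobalMonomial
import Summits.ResolutionOfSingularities.ResolutionOfSingularities.Theorems.MarkedTransferCampaignW46ThreefoldsWitness
import HarnessLib

/-!
# [OURS · L1 W4.6 rung (ii-M)] THE REGIME-(ii) KERNEL WITNESS IS ORDER-REDUCIBLE BY THE MECHANISM — the double plane
# `((x₂)², 2)` in affine 3-space, and every `((x₂)^a, m)`, via the divisorial slice

Cell res-hironaka, LADDER-RESOLUTION rung L (D-0089), slot W4.6, rung (ii) (threefold hypersurfaces); seat res-L1-s46-pv-3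
(gen 3). Host route MarkedTransfer, host item `HypersurfaceOrderReductionDimLeThree` (stmt-ResolutionOfSingularities-16156);
filed `--kind proof --supports` it `--as helper`. Everything here is OURS; NOTHING is a statement of Hironaka's manuscript;
no typed `Hironaka2017` candidate enters except through the bookkeeping `AmbientDatum`/`IdealExponent` records of the
witness file; no named FACT is a hypothesis. AI-written; AI review is weaker than expert review.

## What is proved (no new definitions)

The kernel non-vacuity witness of rung (ii) (`…ThreefoldsWitness.lean`, res-L1-s46-pv-3 gen 2, p490164: the double plane
`doublePlaneExponent K p = ((x₂)², 2)` on `ZA3 K = Spec K[x₀, x₁, x₂]` is a STANDARD UNRESOLVED regime-(ii) state) lies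
in the MONOMIAL SLICE of the dimension ladder (`…ThreefoldsGammaFreeGlobalMonomial.lean`), hence its conclusion holds
for it UNCONDITIONALLY:

* `CampaignW46.germ_secOf3_X_two_not_mem_sq` — at every point `x` of the plane `{x₂ = 0}` the germ of `x₂` is NOT in
  `𝔪_x²` (derivation test with `∂/∂x₂`: `∂(x₂) = 1`; `∂/∂x₂` maps `𝔭_x²` into `𝔭_x`);
* `CampaignW46.isRegular_ZA3` — affine 3-space over a field is a regular scheme (smooth over `Spec K`);
* `CampaignW46.hasSNC_planeIdeal` — the coordinate plane `[𝓘_{x₂ = 0}]` is a simple-normal-crossings boundary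
  (tree `hasSNC_singleton_of_generator`);
* `CampaignW46.orderReducible_planeIdeal_pow` — `OrderReducible ((x₂)^a) m` for every `a` and every `m ≥ 1`;
* `CampaignW46.orderReducible_doublePlane` — **`OrderReducible (doublePlaneExponent K p).J 2`**: the regime-(ii) witness
  state `((x₂)², 2)` is order-reducible by a sequence of permissible blowing-ups (the one-step sequence: blow up the plane
  — a Cartier centre inside `Sing((x₂)², 2) = {x₂ = 0}`, so the blow-up is the identity — and divide by `(x₂)²`).

HONEST VALUE. Small: it closes the loop «the class over which rung (ii) quantifies is inhabited (p490164) AND the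
rung's conclusion holds on that inhabitant», by the mechanism (not by vacuity). It is an instance of the divisorial slice,
nothing more; the non-monomial inputs of rung (ii) are untouched.

References: `…ThreefoldsGammaFreeGlobalMonomial.lean` (this seat, gen 3), `…ThreefoldsWitness.lean` (p490164),
`…ThreefoldsGammaFreeGlobalLadder.lean` (p496755); tree `Resolution/KollarMaxContactPersistence.lean`
(`hasSNC_singleton_of_generator` [Matsumura1987, Thm. 14.2]), `Resolution/AlterationsLemma32.lean`
(`Scheme.IsRegular.of_smooth` [Grothendieck1967, Prop. 17.5.8 (iii)]); pattern of the derivation test: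
`Hironaka2017/Proofs/S14LocalGlobal/Rem1412StrongWitnessPlane.lean` (`germ_not_mem_sq_of_pderiv`, affine plane).
H. Hironaka, ms. 2017-03-23 — scope only, under adjudication, not cited as fact. [Hironaka2017]
-/

noncomputable section

set_option linter.dupNamespace false -- mandated namespace of this single-conjunct summit

open CategoryTheory AlgebraicGeometry TopologicalSpace IsLocalRing

namespace Summit.ResolutionOfSingularities.ResolutionOfSingularities.Theorems

namespace CampaignW46

open Literature.AlgebraicGeometry.Resolution
open Scheme.IdealSheafData

universe u

section Space

variable (K : Type u) [Field K]

/-- **Derivation test for order one on affine 3-space**: at a point `x` of `Spec K[x₀, x₁, x₂]` whose prime `𝔭_x`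
contains `x₂`, the germ of `x₂` does not lie in `𝔪_x²`. (`𝒪_x = K[x]_{𝔭_x}`; if `s · x₂ = j ∈ 𝔭_x²` with `s ∉ 𝔭_x`,
apply `∂/∂x₂`, which maps `𝔭_x²` into `𝔭_x`: `x₂ ∂s + s ∈ 𝔭_x`, so `s ∈ 𝔭_x` — contradiction.) [folklore] -/
theorem germ_secOf3_X_two_not_mem_sq (x : ZA3 K)
    (hx : (MvPolynomial.X 2 : R3 K) ∈ (x : PrimeSpectrum (R3 K)).asIdeal) :
    ((ZA3 K).presheaf.germ ⊤ x trivial).hom (secOf3 K (MvPolynomial.X 2)) ∉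
      maximalIdeal ((ZA3 K).presheaf.stalk x) ^ 2 := by
  letI : Algebra (R3 K) ((ZA3 K).presheaf.stalk x) := StructureSheaf.stalkAlgebra (R3 K) x
  haveI : IsLocalization.AtPrime ((ZA3 K).presheaf.stalk x) x.asIdeal :=
    StructureSheaf.IsLocalization.to_stalk (R3 K) x
  intro hmem
  have hg : ((ZA3 K).presheaf.germ ⊤ x trivial).hom (secOf3 K (MvPolynomial.X 2)) =
      algebraMap (R3 K) ((ZA3 K).presheaf.stalk x) (MvPolynomial.X 2) := rfl
  rw [hg, ← IsLocalization.AtPrime.map_eq_maximalIdeal x.asIdeal ((ZA3 K).presheaf.stalk x),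
    ← Ideal.map_pow, IsLocalization.mem_map_algebraMap_iff x.asIdeal.primeCompl] at hmem
  obtain ⟨⟨⟨j, hj⟩, ⟨s, hs⟩⟩, hrel⟩ := hmem
  simp only at hrel
  have hinj : Function.Injective (algebraMap (R3 K) ((ZA3 K).presheaf.stalk x)) :=
    IsLocalization.injective _ x.asIdeal.primeCompl_le_nonZeroDivisors
  have heq : MvPolynomial.X 2 * s = j := hinj (by rw [map_mul, hrel])
  -- `∂/∂x₂` maps `𝔭²` into `𝔭`
  have hDsq : ∀ k ∈ x.asIdeal ^ 2, MvPolynomial.pderiv 2 k ∈ x.asIdeal := by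
    intro k hk
    rw [pow_two] at hk
    refine Submodule.mul_induction_on hk (fun m hm n hn => ?_)
      (fun a b ha hb => by rw [map_add]; exact add_mem ha hb)
    rw [(MvPolynomial.pderiv 2).leibniz, smul_eq_mul, smul_eq_mul]
    exact add_mem (Ideal.mul_mem_right _ _ hm) (Ideal.mul_mem_right _ _ hn)
  have h1 := hDsq j hj
  rw [← heq, (MvPolynomial.pderiv 2).leibniz, smul_eq_mul, smul_eq_mul, MvPolynomial.pderiv_X,
    Pi.single_eq_same, mul_one] at h1
  -- `x₂ · ∂s + s ∈ 𝔭` and `x₂ ∈ 𝔭` give `s ∈ 𝔭`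
  have h2 : s ∈ x.asIdeal := by
    have := sub_mem h1 (Ideal.mul_mem_right (MvPolynomial.pderiv 2 s) _ hx)
    rwa [add_sub_cancel_left] at this
  exact hs h2

/-- Affine 3-space over a field is a regular scheme (smooth over the regular scheme `Spec K`).
[cite: Grothendieck1967, Prop. 17.5.8 (iii)] -/
theorem isRegular_ZA3 : Scheme.IsRegular (ZA3 K) := by
  haveI := smooth_specSpace K
  exact Scheme.IsRegular.of_smooth (Spec.map (CommRingCat.ofHom (algebraMap K (R3 K))))
    (Scheme.isRegular_Spec (CommRingCat.of K))

/-- The stalk of the plane ideal `𝓘 = (x₂)` at any point is generated by the germ of `x₂`. [folklore] -/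
theorem stalkIdeal_planeIdeal (x : ZA3 K) :
    stalkIdeal (planeIdeal K) x = Ideal.span {((ZA3 K).presheaf.germ ⊤ x trivial).hom (secOf3 K (MvPolynomial.X 2))} := by
  change stalkIdeal (ofIdealTop (Ideal.span {secOf3 K (MvPolynomial.X 2)})) x = _
  rw [stalkIdeal_eq_map_germ _ ⟨⊤, isAffineOpen_top _⟩ (Set.mem_univ x), ofIdealTop_ideal, Ideal.map_map,
    Ideal.map_span, Set.image_singleton]
  congr 2

/-- A point of the support of `𝓘 = (x₂)` has `x₂` in its prime. [folklore] -/
theorem X_two_mem_asIdeal_of_mem_support {x : ZA3 K} (hx : x ∈ (planeIdeal K).support) :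
    (MvPolynomial.X 2 : R3 K) ∈ (x : PrimeSpectrum (R3 K)).asIdeal := by
  have h : x ∈ ((ofIdealTop (Ideal.span {secOf3 K (MvPolynomial.X 2)})).support : Set (ZA3 K)) := hx
  rw [coe_support_ofIdealTop, Scheme.zeroLocus_span, Scheme.mem_zeroLocus_iff] at h
  simp only [Set.mem_singleton_iff, forall_eq] at h
  change x ∉ (ZA3 K).basicOpen ((Scheme.ΓSpecIso (CommRingCat.of (R3 K))).inv.hom (MvPolynomial.X 2)) at h
  rw [basicOpen_eq_of_affine] at h
  by_contra hn
  exact h ((PrimeSpectrum.mem_basicOpen (MvPolynomial.X 2 : R3 K) x).mpr hn)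

/-- **The coordinate plane `{x₂ = 0}` of affine 3-space is a simple-normal-crossings boundary `[𝓘_{x₂ = 0}]`** (regular
ambient; at each point of the plane the stalk ideal is generated by the germ of `x₂`, of order one).
[cite: Matsumura1987, Thm. 14.2] -/
theorem hasSNC_planeIdeal : HasSNC [planeIdeal K] :=
  hasSNC_singleton_of_generator (isRegular_ZA3 K) fun x hx =>
    ⟨_, stalkIdeal_planeIdeal K x, germ_secOf3_X_two_not_mem_sq K x (X_two_mem_asIdeal_of_mem_support K hx)⟩

/-- **Every `((x₂)^a, m)` on affine 3-space is order-reducible** (`m ≥ 1`), by the divisorial slice. [folklore] -/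
theorem orderReducible_planeIdeal_pow (a : ℕ) {m : ℕ} (hm : 1 ≤ m) : OrderReducible (planeIdeal K ^ a) m :=
  orderReducible_pow_of_hasSNC_singleton (hasSNC_planeIdeal K) a hm

variable (p : ℕ) [Fact p.Prime] [CharP K p]

/-- **THE REGIME-(ii) KERNEL WITNESS IS ORDER-REDUCIBLE.** The double plane `((x₂)², 2)` on affine 3-space — the standard
unresolved regime-(ii) state of `doublePlane_witness` (p490164) — satisfies the conclusion of the rung-(ii) statement:
`OrderReducible (doublePlaneExponent K p).J (doublePlaneExponent K p).b`, i.e. there is a sequence of permissible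
blowing-ups for `((x₂)², 2)` ending below order `2` everywhere (blow up the plane once: a Cartier centre inside the
singular locus, identity blow-up, controlled transform `𝒪`). [folklore] -/
theorem orderReducible_doublePlane :
    OrderReducible (doublePlaneExponent K p).J (doublePlaneExponent K p).b :=
  orderReducible_planeIdeal_pow K 2 (show 1 ≤ 2 by norm_num)

/-- The witness package in one line: the double plane is a standard unresolved regime-(ii) state AND order-reducible by
permissible blowing-ups. [folklore] -/
theorem doublePlane_witness_orderReducible :
    regimeII (spaceAmbientDatum K p) (doublePlaneExponent K p) ∧ (doublePlaneExponent K p).IsStandard ∧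
      (doublePlaneExponent K p).sing.Nonempty ∧
        OrderReducible (doublePlaneExponent K p).J (doublePlaneExponent K p).b :=
  let ⟨h1, h2, h3⟩ := doublePlane_witness K p
  ⟨h1, h2, h3, orderReducible_doublePlane K p⟩

end Space

end CampaignW46

end Summit.ResolutionOfSingularities.ResolutionOfSingularities.Theorems

end
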